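import Literature.NumberTheory.PAdicHodge.TateTwistInvariants
import Mathlib.RingTheory.Trace.Basic
import Mathlib.LinearAlgebra.BilinearForm.Properties
import HarnessLib

/-!
# The degree-one transfer `Γ_F ≤ Gal(F̄/ℚ_p)` for twisted `ℂ_F`-valued cocycles (corestriction and a trace-dual basis)

Continuation of `TateTwistInvariants` (the transversal `s_φ`, `φ : F → F̄` over `K₀ ≅ ℚ_p`, of
`Γ_F = Gal(F̄/F)` in `G₀ = Gal(F̄/K₀)`, with `g s_φ = s_{gφ} h_φ(g)`, `h_φ(g) ∈ Γ_F`). Notation as there;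
`ι : K₀ → ℂ_F`, `W g = χ(g) ∈ K₀`, and for `j ∈ ℤ` the TWISTED action `g ⋆ x = ι(χ(g))^j · g x` of `G₀` on
`ℂ_F` (the Tate twist `ℂ_F(χ^j)`). We work inside `G₀`, with `Γ_F` the subgroup `H = range toBase` of
elements fixing `F`.

Tate's `H¹` theorems (1967, §3.3) are proved in the tree over the BASE group `G₀` (normalised traces of the
tower `ℚ_p(μ_{p^∞})`: `TateNormalizedTrace`, `TateInvariantsBase`, `TateTwistCoboundary`, `TateSenCocycles`).
This file supplies the purely algebraic TRANSFER from `G₀` to the finite-index subgroup `Γ_F` at the level of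
cocycles (degree-one Shapiro lemma made explicit; Serre, *Local Fields*, VII §5–§7):

* `twistedCor j c g = Σ_φ s_{gφ} ⋆ c(h_φ(g))` — the **corestriction cochain** of a cochain `c` on `H`;
  `twistedCor_mul`: it is a twisted `1`-cocycle on `G₀` when `c` is a twisted `1`-cocycle on `H`
  (`TateDescent.corr_mul`: `h_φ(gg') = h_{g'φ}(g) h_φ(g')`).
* `sum_traceDual_mul_emb_eq` — the **trace-dual basis identity**: for a `K₀`-basis `(eᵢ)` of `F` with
  trace-dual basis `(eᵢ')`, `Σᵢ eᵢ' · φ(eᵢ) = [φ = φ₀]` in `F̄` (`φ₀ = F ⊆ F̄`; Dedekind independence of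
  embeddings, Mathlib `linearIndependent_monoidHom`, and `Tr = Σ_φ φ`, Mathlib `trace_eq_sum_embeddings`).
* `sum_traceDual_mul_twistedCor_eq` — the **reconstruction identity** on `H`:
  `Σᵢ eᵢ' · cor(eᵢ c)(h) = c(h) + (h ⋆ c(s₀) − c(s₀))`, `s₀ = s_{φ₀} ∈ H`.
* `exists_eq_twistedCoboundary_of_forall_twistedCor` — **TRANSFER**: if each `G₀`-cocycle `cor(eᵢ c)` is a
  twisted coboundary PLUS a multiple `ι(aᵢ)·ℓ` of a fixed additive function `ℓ : G₀ → ℂ_F` with values fixed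
  by `H` on `F` (e.g. `ℓ = log χ`, or `ℓ = 0`), then on `H` the cocycle `c` is a twisted coboundary plus
  `a·ℓ` with `a = Σ aᵢ eᵢ' ∈ F` (`ℓ = 0`: Tate's `H¹(Γ_F, ℂ_F(χ^j)) = 0` from `H¹(G₀, ℂ_F(χ^j)) = 0`;
  `j = 0`, `ℓ = log χ`: `H¹(Γ_F, ℂ_F) = F·[log χ]` from `H¹(G₀, ℂ_F) = ℚ_p·[log χ]`).

Everything is finite algebra; the continuity of `cor(eᵢ c)` for continuous `c` (needed to feed the `G₀`-level
theorems) is the sequel's business. No named fact, no `sorry`, no instance.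

## References

* J. Tate, *p-divisible groups* (1967), §3.3 Theorems 1–2. [Tate1967]
* J.-P. Serre, *Local Fields* (1979), Ch. VII §5 (restriction, corestriction), §7. [SerreLocalFields1979]
-/

noncomputable section

open ValuativeRel Field Finset

open scoped IntermediateField

namespace Literature.NumberTheory.PAdicHodge

open Literature.NumberTheory.GaloisRepresentations
open Literature.NumberTheory.GaloisRepresentations.IsNonarchimedeanLocalField

variable {F : Type} [Field F] [ValuativeRel F] [TopologicalSpace F] [IsNonarchimedeanLocalField F]
  [CharZero F] {p : ℕ} [Fact p.Prime] (hp : valuation F p < 1)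

namespace TateDescent

/-! ### Group-theoretic complements on the transversal -/

/-- `φ ↦ gφ` is an action: `(gg')φ = g(g'φ)`. [cite: SerreLocalFields1979, Ch. VII §5] -/
theorem permEmb_mul (g g' : BaseGaloisGroup hp) (φ : Emb hp) :
    permEmb hp (g * g') φ = permEmb hp g (permEmb hp g' φ) := AlgHom.ext fun _ => rfl

/-- `1φ = φ`. [cite: SerreLocalFields1979, Ch. VII §5] -/
theorem permEmb_one (φ : Emb hp) : permEmb hp 1 φ = φ := AlgHom.ext fun _ => rfl
/-- **The corrections are a `1`-cocycle**: `h_φ(gg') = h_{g'φ}(g) · h_φ(g')`. [cite: SerreLocalFields1979, Ch. VII §5] -/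
theorem corr_mul (g g' : BaseGaloisGroup hp) (φ : Emb hp) :
    corr hp (g * g') φ = corr hp g (permEmb hp g' φ) * corr hp g' φ := by
  unfold corr
  rw [permEmb_mul]
  group

/-- Elements of `range toBase` fix `F ⊆ ℂ_F`. [cite: SerreLocalFields1979, Ch. VII §5] -/
theorem smul_algebraMap_of_mem_range {h : BaseGaloisGroup hp} (hh : h ∈ Set.range (BaseGaloisGroup.toBase hp))
    (x : F) : h • algebraMap F (CompletedAlgClosure F) x = algebraMap F (CompletedAlgClosure F) x := by
  obtain ⟨σ, rfl⟩ := hh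
  exact CompletedAlgClosure.toBase_smul_algebraMap_completion hp σ x

/-- `range toBase` is closed under multiplication. [cite: SerreLocalFields1979, Ch. VII §5] -/
theorem mul_mem_range {h h' : BaseGaloisGroup hp} (hh : h ∈ Set.range (BaseGaloisGroup.toBase hp))
    (hh' : h' ∈ Set.range (BaseGaloisGroup.toBase hp)) : h * h' ∈ Set.range (BaseGaloisGroup.toBase hp) := by
  obtain ⟨σ, rfl⟩ := hh; obtain ⟨τ, rfl⟩ := hh'
  exact ⟨σ * τ, map_mul _ _ _⟩

/-- `1 ∈ range toBase`. [cite: SerreLocalFields1979, Ch. VII §5] -/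
theorem one_mem_range : (1 : BaseGaloisGroup hp) ∈ Set.range (BaseGaloisGroup.toBase hp) := ⟨1, map_one _⟩

/-- `range toBase` is closed under inverses. [cite: SerreLocalFields1979, Ch. VII §5] -/
theorem inv_mem_range {h : BaseGaloisGroup hp} (hh : h ∈ Set.range (BaseGaloisGroup.toBase hp)) :
    h⁻¹ ∈ Set.range (BaseGaloisGroup.toBase hp) := by
  obtain ⟨σ, rfl⟩ := hh; exact ⟨σ⁻¹, map_inv _ _⟩

/-- An element `h ∈ range toBase` permutes the embeddings trivially on `φ₀`: `hφ₀ = φ₀`. [cite: SerreLocalFields1979, Ch. VII §5] -/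
theorem permEmb_emb₀_of_mem_range {h : BaseGaloisGroup hp} (hh : h ∈ Set.range (BaseGaloisGroup.toBase hp)) :
    permEmb hp h (emb₀ hp) = emb₀ hp := by
  obtain ⟨σ, rfl⟩ := hh
  refine AlgHom.ext fun x => ?_
  rw [permEmb_apply]
  exact BaseGaloisGroup.toBase_smul_algebraMap hp σ x

/-- `s₀ = s_{φ₀}` fixes `F`: `s₀ ∈ range toBase`. [cite: SerreLocalFields1979, Ch. VII §5] -/
theorem liftEmb_emb₀_mem_range : liftEmb hp (emb₀ hp) ∈ Set.range (BaseGaloisGroup.toBase hp) :=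
  BaseGaloisGroup.exists_toBase_eq hp _ fun x => liftEmb_algebraMap hp (emb₀ hp) x

/-- For `h ∈ range toBase`: `h_{φ₀}(h) = s₀⁻¹ h s₀`. [cite: SerreLocalFields1979, Ch. VII §5] -/
theorem corr_emb₀_of_mem_range {h : BaseGaloisGroup hp} (hh : h ∈ Set.range (BaseGaloisGroup.toBase hp)) :
    corr hp h (emb₀ hp) = (liftEmb hp (emb₀ hp))⁻¹ * h * liftEmb hp (emb₀ hp) := by
  rw [corr, permEmb_emb₀_of_mem_range hp hh]

/-- `s_ψ` acts on `F ⊆ ℂ_F` through `ψ`: `s_ψ • x = ψ(x)`. [cite: SerreLocalFields1979, Ch. VII §5] -/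
theorem liftEmb_smul_algebraMap (ψ : Emb hp) (x : F) :
    liftEmb hp ψ • algebraMap F (CompletedAlgClosure F) x = ((ψ x : NormedAlgClosure F) : CompletedAlgClosure F) := by
  rw [CompletedAlgClosure.algebraMap_eq_coe, CompletedAlgClosure.base_smul_coe, BaseGaloisGroup.smul_def,
    liftEmb_algebraMap]

/-! ### The twisted action and the corestriction cochain -/

/-- The weight `u_j(g) = ι(χ(g))^j` of the twist `ℂ_F(χ^j)` is multiplicative. [cite: SerreLocalFields1979, Ch. VII §5] -/
theorem ι_W_zpow_mul (j : ℤ) (g g' : BaseGaloisGroup hp) :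
    TateTrace.ι hp (W hp (g * g')) ^ j = TateTrace.ι hp (W hp g) ^ j * TateTrace.ι hp (W hp g') ^ j := by
  rw [map_mul, ← TateTrace.ιHom_apply, map_mul, mul_zpow, TateTrace.ιHom_apply, TateTrace.ιHom_apply]

/-- The weights are `G₀`-invariant scalars. [cite: SerreLocalFields1979, Ch. VII §5] -/
theorem smul_ι_W_zpow (j : ℤ) (g g' : BaseGaloisGroup hp) :
    g • TateTrace.ι hp (W hp g') ^ j = TateTrace.ι hp (W hp g') ^ j := by
  have h : g • TateTrace.ι hp (W hp g') ^ j = (g • TateTrace.ι hp (W hp g')) ^ j :=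
    map_zpow₀ (MulSemiringAction.toRingHom (BaseGaloisGroup hp) (CompletedAlgClosure F) g) _ _
  rw [h, TateTrace.base_smul_ι]

/-- **The corestriction cochain** of `c : G₀ → ℂ_F` (used only on `H = range toBase`) for the twist `χ^j`:
`cor_j(c)(g) = Σ_φ ι(χ(s_{gφ}))^j · s_{gφ} • c(h_φ(g))` (`= Σ_φ s_{gφ} ⋆ c(h_φ(g))`).
[cite: SerreLocalFields1979, Ch. VII §5] -/
def twistedCor (j : ℤ) (c : BaseGaloisGroup hp → CompletedAlgClosure F) (g : BaseGaloisGroup hp) :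
    CompletedAlgClosure F :=
  ∑ φ : Emb hp, TateTrace.ι hp (W hp (liftEmb hp (permEmb hp g φ))) ^ j *
    (liftEmb hp (permEmb hp g φ) • c (corr hp g φ))

/-- Unfolding of `twistedCor`. [cite: SerreLocalFields1979, Ch. VII §5] -/
theorem twistedCor_apply (j : ℤ) (c : BaseGaloisGroup hp → CompletedAlgClosure F) (g : BaseGaloisGroup hp) :
    twistedCor hp j c g = ∑ φ : Emb hp, TateTrace.ι hp (W hp (liftEmb hp (permEmb hp g φ))) ^ j *
      (liftEmb hp (permEmb hp g φ) • c (corr hp g φ)) := rfl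

/-- `cor` commutes with multiplication by a `G₀`-INVARIANT scalar. [cite: SerreLocalFields1979, Ch. VII §5] -/
theorem twistedCor_const_mul (j : ℤ) {a : CompletedAlgClosure F} (ha : ∀ g : BaseGaloisGroup hp, g • a = a)
    (c : BaseGaloisGroup hp → CompletedAlgClosure F) (g : BaseGaloisGroup hp) :
    twistedCor hp j (fun h => a * c h) g = a * twistedCor hp j c g := by
  rw [twistedCor_apply, twistedCor_apply, Finset.mul_sum]
  refine Finset.sum_congr rfl fun φ _ => ?_
  rw [smul_mul', ha]
  ring

/-- **`cor` of a twisted `1`-cocycle on `H` is a twisted `1`-cocycle on `G₀`**: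
`cor(c)(gg') = cor(c)(g) + u_j(g) · g • cor(c)(g')`. Uses `h_φ(gg') = h_{g'φ}(g) h_φ(g')`, `g s_{g'φ} =
s_{gg'φ} h_{g'φ}(g)`, and the reindexing `φ ↦ g'φ`. [cite: SerreLocalFields1979, Ch. VII §5] -/
theorem twistedCor_mul (j : ℤ) {c : BaseGaloisGroup hp → CompletedAlgClosure F}
    (hc : ∀ h h' : BaseGaloisGroup hp, h ∈ Set.range (BaseGaloisGroup.toBase hp) →
      h' ∈ Set.range (BaseGaloisGroup.toBase hp) →
        c (h * h') = c h + TateTrace.ι hp (W hp h) ^ j * (h • c h'))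
    (g g' : BaseGaloisGroup hp) :
    twistedCor hp j c (g * g') = twistedCor hp j c g + TateTrace.ι hp (W hp g) ^ j * (g • twistedCor hp j c g') := by
  classical
  -- expand `c (h_φ(gg'))` by the cocycle identity
  have hexp : ∀ φ : Emb hp, c (corr hp (g * g') φ) =
      c (corr hp g (permEmb hp g' φ)) + TateTrace.ι hp (W hp (corr hp g (permEmb hp g' φ))) ^ j *
        (corr hp g (permEmb hp g' φ) • c (corr hp g' φ)) := fun φ => by
    rw [corr_mul]
    exact hc _ _ (exists_toBase_eq_corr hp _ _) (exists_toBase_eq_corr hp _ _)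
  -- the second sum, pushed through `g •`
  have hsmul : g • twistedCor hp j c g' = ∑ φ : Emb hp, TateTrace.ι hp (W hp (liftEmb hp (permEmb hp g' φ))) ^ j *
      ((g * liftEmb hp (permEmb hp g' φ)) • c (corr hp g' φ)) := by
    rw [twistedCor_apply, smul_sum]
    exact Finset.sum_congr rfl fun φ _ => by rw [smul_mul', smul_ι_W_zpow, mul_smul]
  rw [hsmul, mul_sum, twistedCor_apply, twistedCor_apply]
  -- reindex the first sum on the right by `φ ↦ g'φ`
  rw [← Equiv.sum_comp (permEmb hp g') (fun ψ => TateTrace.ι hp (W hp (liftEmb hp (permEmb hp g ψ))) ^ j *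
      (liftEmb hp (permEmb hp g ψ) • c (corr hp g ψ))), ← Finset.sum_add_distrib]
  refine Finset.sum_congr rfl fun φ _ => ?_
  rw [permEmb_mul, hexp φ, smul_add, mul_add]
  congr 1
  rw [smul_mul', smul_ι_W_zpow, ← mul_smul, ← mul_assoc, ← ι_W_zpow_mul, ← mul_liftEmb, ι_W_zpow_mul,
    mul_assoc]

/-! ### The trace-dual basis identity -/

/-- **Trace-dual basis identity** (in `ℂ_F`). For a `K₀`-basis `e` of `F` with trace-dual basis `e'`
(`Tr_{F/K₀}(e'ᵢ eⱼ) = δᵢⱼ`) and an embedding `φ : F → F̄` over `K₀`: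
`Σᵢ e'ᵢ · φ(eᵢ) = 1` if `φ` is the inclusion `φ₀` and `= 0` otherwise (`e'ᵢ` through `F ⊆ ℂ_F`, `φ(eᵢ)`
through `F̄ ⊆ ℂ_F`). Proof: for every `x ∈ F`, `Σ_φ (Σᵢ e'ᵢ φ(eᵢ)) · φ(x) = Σᵢ e'ᵢ Tr(x eᵢ) = x = φ₀(x)`
(dual-basis expansion and `Tr = Σ_φ φ`, Mathlib `trace_eq_sum_embeddings`), and the distinct embeddings are
linearly independent over `ℂ_F` (Dedekind, Mathlib `linearIndependent_monoidHom`). [cite: SerreLocalFields1979, Ch. III §3] -/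
theorem sum_traceDual_mul_emb_eq {κ : Type*} [Fintype κ] [DecidableEq κ] [DecidableEq (Emb hp)]
    (e : Module.Basis κ (PadicBase F p hp) F) (φ : Emb hp) :
    ∑ i, algebraMap F (CompletedAlgClosure F)
        ((Algebra.traceForm (PadicBase F p hp) F).dualBasis (traceForm_nondegenerate (PadicBase F p hp) F) e i) *
      ((φ (e i) : NormedAlgClosure F) : CompletedAlgClosure F) = if φ = emb₀ hp then 1 else 0 := by
  set e' := (Algebra.traceForm (PadicBase F p hp) F).dualBasis (traceForm_nondegenerate (PadicBase F p hp) F) e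
    with he'
  set Ψ : Emb hp → (F →* CompletedAlgClosure F) := fun ψ =>
    (UniformSpace.Completion.coeRingHom : NormedAlgClosure F →+* CompletedAlgClosure F).toMonoidHom.comp
      (ψ : F →ₐ[PadicBase F p hp] NormedAlgClosure F).toMonoidHom with hΨ
  have hΨ_apply : ∀ (ψ : Emb hp) (y : F), Ψ ψ y = ((ψ y : NormedAlgClosure F) : CompletedAlgClosure F) :=
    fun _ _ => rfl
  set A : Emb hp → CompletedAlgClosure F :=
    fun ψ => ∑ i, algebraMap F (CompletedAlgClosure F) (e' i) * Ψ ψ (e i) with hA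
  -- `Tr = Σ_ψ ψ`, in `ℂ_F`
  have htr : ∀ y : F, ∑ ψ : Emb hp, Ψ ψ y = algebraMap F (CompletedAlgClosure F)
      (algebraMap (PadicBase F p hp) F (Algebra.trace (PadicBase F p hp) F y)) := fun y => by
    have h1 := trace_eq_sum_embeddings (NormedAlgClosure F) (K := PadicBase F p hp) (L := F) (x := y)
    rw [IsScalarTower.algebraMap_apply (PadicBase F p hp) F (NormedAlgClosure F)] at h1
    have h2 := congrArg (UniformSpace.Completion.coeRingHom : NormedAlgClosure F →+* CompletedAlgClosure F) h1
    rw [map_sum] at h2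
    rw [CompletedAlgClosure.algebraMap_eq_coe]
    exact h2.symm
  -- the dual-basis expansion `Σ_ψ A ψ · ψ(x) = x`
  have hexp : ∀ x : F, ∑ ψ : Emb hp, A ψ * Ψ ψ x = algebraMap F (CompletedAlgClosure F) x := by
    intro x
    calc ∑ ψ : Emb hp, A ψ * Ψ ψ x
        = ∑ ψ : Emb hp, ∑ i, algebraMap F (CompletedAlgClosure F) (e' i) * Ψ ψ (x * e i) := by
          refine Finset.sum_congr rfl fun ψ _ => ?_
          rw [hA, Finset.sum_mul]
          exact Finset.sum_congr rfl fun i _ => by rw [map_mul]; ring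
      _ = ∑ i, algebraMap F (CompletedAlgClosure F) (e' i) * ∑ ψ : Emb hp, Ψ ψ (x * e i) := by
          rw [Finset.sum_comm]
          exact Finset.sum_congr rfl fun i _ => by rw [Finset.mul_sum]
      _ = algebraMap F (CompletedAlgClosure F) (∑ i, (Algebra.trace (PadicBase F p hp) F (x * e i)) • e' i) := by
          rw [map_sum]
          refine Finset.sum_congr rfl fun i _ => ?_
          rw [htr, Algebra.smul_def, (algebraMap F (CompletedAlgClosure F)).map_mul, mul_comm]
      _ = algebraMap F (CompletedAlgClosure F) x := by
          congr 1
          conv_rhs => rw [← e'.sum_repr x]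
          refine Finset.sum_congr rfl fun i _ => ?_
          rw [he', LinearMap.BilinForm.dualBasis_repr_apply, Algebra.traceForm_apply]
  have hind := linearIndependent_monoidHom F (CompletedAlgClosure F)  -- Dedekind independence
  have hinj : Function.Injective Ψ := by
    intro ψ ψ' h
    refine AlgHom.ext fun x => UniformSpace.Completion.coe_injective (NormedAlgClosure F) ?_
    rw [← hΨ_apply, ← hΨ_apply, h]
  have hrel : ∑ ψ : Emb hp, (A ψ - if ψ = emb₀ hp then 1 else 0) • (Ψ ψ : F → CompletedAlgClosure F) = 0 := by
    funext x
    rw [Finset.sum_apply, Pi.zero_apply]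
    simp only [Pi.smul_apply, smul_eq_mul, sub_mul, Finset.sum_sub_distrib, ite_mul, one_mul, zero_mul,
      Finset.sum_ite_eq', Finset.mem_univ, if_true, hexp x]
    rw [hΨ_apply, sub_eq_zero]
    exact (CompletedAlgClosure.algebraMap_eq_coe x)
  have hcoef := hind.comp _ hinj
  rw [Fintype.linearIndependent_iff] at hcoef
  have h := sub_eq_zero.mp (hcoef (fun ψ => A ψ - if ψ = emb₀ hp then 1 else 0) hrel φ)
  rw [hA] at h
  exact h

/-! ### The reconstruction identity on `H = Γ_F` -/

section Reconstruction

variable {j : ℤ} {c : BaseGaloisGroup hp → CompletedAlgClosure F}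
  (hc : ∀ h h' : BaseGaloisGroup hp, h ∈ Set.range (BaseGaloisGroup.toBase hp) →
    h' ∈ Set.range (BaseGaloisGroup.toBase hp) →
      c (h * h') = c h + TateTrace.ι hp (W hp h) ^ j * (h • c h'))
include hc

/-- A twisted cocycle vanishes at `1`. [cite: SerreLocalFields1979, Ch. VII §5] -/
private theorem apply_one_eq_zero_of_cocycle : c 1 = 0 := by
  have h := hc 1 1 (one_mem_range hp) (one_mem_range hp)
  rw [mul_one, one_smul, map_one, ← TateTrace.ιHom_apply, map_one, one_zpow, one_mul] at h
  exact left_eq_add.mp h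

/-- **Conjugation acts trivially on `H¹` (cochain form)**: for `s, h ∈ H`,
`s ⋆ c(s⁻¹ h s) = c(h) + (h ⋆ c(s) − c(s))`. [cite: SerreLocalFields1979, Ch. VII §5] -/
theorem twist_smul_apply_conj {s h : BaseGaloisGroup hp} (hs : s ∈ Set.range (BaseGaloisGroup.toBase hp))
    (hh : h ∈ Set.range (BaseGaloisGroup.toBase hp)) :
    TateTrace.ι hp (W hp s) ^ j * (s • c (s⁻¹ * h * s)) =
      c h + (TateTrace.ι hp (W hp h) ^ j * (h • c s) - c s) := by
  have hs' := inv_mem_range hp hs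
  have h1 := hc (s⁻¹ * h) s (mul_mem_range hp hs' hh) hs
  have h2 := hc s⁻¹ h hs' hh
  have h3 := hc s⁻¹ s hs' hs
  rw [inv_mul_cancel, apply_one_eq_zero_of_cocycle hp hc] at h3
  have h4 : c s⁻¹ = -(TateTrace.ι hp (W hp s⁻¹) ^ j * (s⁻¹ • c s)) := eq_neg_of_add_eq_zero_left h3.symm
  have hι1 : TateTrace.ι hp (1 : PadicBase F p hp) = 1 := by rw [← TateTrace.ιHom_apply, map_one]
  have hUinv : TateTrace.ι hp (W hp s) ^ j * TateTrace.ι hp (W hp s⁻¹) ^ j = 1 := by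
    rw [← ι_W_zpow_mul, mul_inv_cancel, map_one, hι1, one_zpow]
  have hU2 : TateTrace.ι hp (W hp s) ^ j * TateTrace.ι hp (W hp (s⁻¹ * h)) ^ j = TateTrace.ι hp (W hp h) ^ j := by
    rw [← ι_W_zpow_mul, mul_inv_cancel_left]
  rw [h1, h2, h4]
  simp only [smul_add, smul_neg, smul_mul', smul_ι_W_zpow, ← mul_smul, mul_inv_cancel, one_smul,
    mul_inv_cancel_left]
  linear_combination (c h - c s) * hUinv + (h • c s) * hU2

variable {κ : Type*} [Fintype κ] [DecidableEq κ] (e : Module.Basis κ (PadicBase F p hp) F)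

/-- **Reconstruction identity**: for `h ∈ H`, `Σᵢ e'ᵢ · cor_j(eᵢ c)(h) = c(h) + (h ⋆ c(s₀) − c(s₀))` (`s₀ = s_{φ₀}`;
the weights `Σᵢ e'ᵢ·(hφ)(eᵢ)` kill every `φ` but `φ₀`, leaving `s₀ ⋆ c(s₀⁻¹ h s₀)`). [cite: SerreLocalFields1979, Ch. VII §5 and §7] -/
theorem sum_traceDual_mul_twistedCor_eq {h : BaseGaloisGroup hp} (hh : h ∈ Set.range (BaseGaloisGroup.toBase hp)) :
    ∑ i, algebraMap F (CompletedAlgClosure F)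
        ((Algebra.traceForm (PadicBase F p hp) F).dualBasis (traceForm_nondegenerate (PadicBase F p hp) F) e i) *
      twistedCor hp j (fun g => algebraMap F (CompletedAlgClosure F) (e i) * c g) h =
      c h + (TateTrace.ι hp (W hp h) ^ j * (h • c (liftEmb hp (emb₀ hp))) - c (liftEmb hp (emb₀ hp))) := by
  classical
  set e' := (Algebra.traceForm (PadicBase F p hp) F).dualBasis (traceForm_nondegenerate (PadicBase F p hp) F) e
    with he'
  -- `hφ = φ₀ ↔ φ = φ₀` for `h ∈ H`
  have hiff : ∀ φ : Emb hp, permEmb hp h φ = emb₀ hp ↔ φ = emb₀ hp := by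
    intro φ
    constructor
    · intro hφ
      have : φ = permEmb hp h⁻¹ (permEmb hp h φ) := by rw [← permEmb_mul, inv_mul_cancel, permEmb_one]
      rw [this, hφ, permEmb_emb₀_of_mem_range hp (inv_mem_range hp hh)]
    · rintro rfl; exact permEmb_emb₀_of_mem_range hp hh
  calc ∑ i, algebraMap F (CompletedAlgClosure F) (e' i) *
        twistedCor hp j (fun g => algebraMap F (CompletedAlgClosure F) (e i) * c g) h
      = ∑ φ : Emb hp, (∑ i, algebraMap F (CompletedAlgClosure F) (e' i) *
            ((permEmb hp h φ (e i) : NormedAlgClosure F) : CompletedAlgClosure F)) *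
          (TateTrace.ι hp (W hp (liftEmb hp (permEmb hp h φ))) ^ j *
            (liftEmb hp (permEmb hp h φ) • c (corr hp h φ))) := by
        simp only [twistedCor_apply, Finset.mul_sum, smul_mul', liftEmb_smul_algebraMap]
        rw [Finset.sum_comm]
        refine Finset.sum_congr rfl fun φ _ => ?_
        rw [Finset.sum_mul]
        exact Finset.sum_congr rfl fun i _ => by ring
    _ = ∑ φ : Emb hp, (if φ = emb₀ hp then (1 : CompletedAlgClosure F) else 0) *
          (TateTrace.ι hp (W hp (liftEmb hp (permEmb hp h φ))) ^ j *
            (liftEmb hp (permEmb hp h φ) • c (corr hp h φ))) := by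
        refine Finset.sum_congr rfl fun φ _ => ?_
        rw [he', sum_traceDual_mul_emb_eq hp e (permEmb hp h φ)]
        congr 1
        exact if_congr (hiff φ) rfl rfl
    _ = TateTrace.ι hp (W hp (liftEmb hp (permEmb hp h (emb₀ hp)))) ^ j *
          (liftEmb hp (permEmb hp h (emb₀ hp)) • c (corr hp h (emb₀ hp))) := by
        simp only [ite_mul, one_mul, zero_mul, Finset.sum_ite_eq', Finset.mem_univ, if_true]
    _ = c h + (TateTrace.ι hp (W hp h) ^ j * (h • c (liftEmb hp (emb₀ hp))) - c (liftEmb hp (emb₀ hp))) := by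
        rw [permEmb_emb₀_of_mem_range hp hh, corr_emb₀_of_mem_range hp hh]
        exact twist_smul_apply_conj hp hc (liftEmb_emb₀_mem_range hp) hh

/-- **TRANSFER `G₀ ⇝ Γ_F` for twisted cocycles.** For a `χ^j`-twisted `1`-cocycle `c` on `H = Γ_F ≤ G₀`, a
`K₀`-basis `e` of `F` (trace-dual basis `e'`) and ANY `ℓ : G₀ → ℂ_F`: if each `cor_j(eᵢ c)` is, on `G₀`, a
twisted coboundary plus `ι(aᵢ)·ℓ`, then on `H`, `c(h) = ι(χ(h))^j · h B − B + a·ℓ(h)` with `a = Σ aᵢ e'ᵢ ∈ F`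
(degree-one corestriction/Shapiro, explicit). [cite: SerreLocalFields1979, Ch. VII §5 and §7] [cite: Tate1967, §3.3 Theorems 1–2] -/
theorem exists_eq_twistedCoboundary_of_forall_twistedCor (ℓ : BaseGaloisGroup hp → CompletedAlgClosure F)
    (a : κ → PadicBase F p hp) (b : κ → CompletedAlgClosure F)
    (hcor : ∀ (i : κ) (g : BaseGaloisGroup hp),
      twistedCor hp j (fun g' => algebraMap F (CompletedAlgClosure F) (e i) * c g') g =
        TateTrace.ι hp (W hp g) ^ j * (g • b i) - b i + TateTrace.ι hp (a i) * ℓ g) :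
    ∃ (B : CompletedAlgClosure F) (A : F), ∀ h : BaseGaloisGroup hp, h ∈ Set.range (BaseGaloisGroup.toBase hp) →
      c h = TateTrace.ι hp (W hp h) ^ j * (h • B) - B + algebraMap F (CompletedAlgClosure F) A * ℓ h := by
  classical
  set e' := (Algebra.traceForm (PadicBase F p hp) F).dualBasis (traceForm_nondegenerate (PadicBase F p hp) F) e
    with he'
  refine ⟨∑ i, algebraMap F (CompletedAlgClosure F) (e' i) * b i - c (liftEmb hp (emb₀ hp)),
    ∑ i, a i • e' i, fun h hh => ?_⟩
  have hrec := sum_traceDual_mul_twistedCor_eq hp hc e hh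
  rw [Finset.sum_congr rfl fun i _ => by rw [hcor i h]] at hrec
  -- `h` fixes the scalars `e'ᵢ`
  have hfix : ∀ i, h • algebraMap F (CompletedAlgClosure F) (e' i) = algebraMap F (CompletedAlgClosure F) (e' i) :=
    fun i => smul_algebraMap_of_mem_range hp hh _
  have hA : algebraMap F (CompletedAlgClosure F) (∑ i, a i • e' i) =
      ∑ i, algebraMap F (CompletedAlgClosure F) (e' i) * TateTrace.ι hp (a i) := by
    rw [map_sum]
    refine Finset.sum_congr rfl fun i _ => ?_
    rw [Algebra.smul_def, map_mul, TateTrace.ι_def, mul_comm]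
  have hS1 : ∑ i, algebraMap F (CompletedAlgClosure F) (e' i) * (TateTrace.ι hp (W hp h) ^ j * (h • b i)) =
      TateTrace.ι hp (W hp h) ^ j * (h • ∑ i, algebraMap F (CompletedAlgClosure F) (e' i) * b i) := by
    rw [smul_sum, Finset.mul_sum]
    refine Finset.sum_congr rfl fun i _ => ?_
    rw [smul_mul', hfix i]
    ring
  have hS3 : ∑ i, algebraMap F (CompletedAlgClosure F) (e' i) * (TateTrace.ι hp (a i) * ℓ h) =
      algebraMap F (CompletedAlgClosure F) (∑ i, a i • e' i) * ℓ h := by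
    rw [hA, Finset.sum_mul]
    exact Finset.sum_congr rfl fun i _ => by ring
  have hsum : ∑ i, algebraMap F (CompletedAlgClosure F) (e' i) *
      (TateTrace.ι hp (W hp h) ^ j * (h • b i) - b i + TateTrace.ι hp (a i) * ℓ h) =
      TateTrace.ι hp (W hp h) ^ j * (h • ∑ i, algebraMap F (CompletedAlgClosure F) (e' i) * b i) -
        ∑ i, algebraMap F (CompletedAlgClosure F) (e' i) * b i +
        algebraMap F (CompletedAlgClosure F) (∑ i, a i • e' i) * ℓ h := by
    simp only [mul_add, mul_sub, Finset.sum_add_distrib, Finset.sum_sub_distrib, hS1, hS3]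
  rw [hsum] at hrec
  rw [smul_sub, mul_sub]
  linear_combination (-1 : CompletedAlgClosure F) * hrec

/-- **Tate's `H¹(Γ_F, ℂ_F(χ^j))` from `H¹(G₀, ℂ_F(χ^j))`** (case `ℓ = 0`): if every `cor_j(eᵢ c)` is a twisted
coboundary on `G₀`, then `c` is a twisted coboundary on `H = Γ_F`. [cite: Tate1967, §3.3 Theorem 2] -/
theorem exists_eq_twistedCoboundary_of_forall_twistedCor_eq_coboundary (b : κ → CompletedAlgClosure F)
    (hcor : ∀ (i : κ) (g : BaseGaloisGroup hp),
      twistedCor hp j (fun g' => algebraMap F (CompletedAlgClosure F) (e i) * c g') g =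
        TateTrace.ι hp (W hp g) ^ j * (g • b i) - b i) :
    ∃ B : CompletedAlgClosure F, ∀ h : BaseGaloisGroup hp, h ∈ Set.range (BaseGaloisGroup.toBase hp) →
      c h = TateTrace.ι hp (W hp h) ^ j * (h • B) - B := by
  obtain ⟨B, A, hB⟩ := exists_eq_twistedCoboundary_of_forall_twistedCor hp hc e (fun _ => 0) (fun _ => 0) b
    (fun i g => by rw [hcor i g, mul_zero, add_zero])
  exact ⟨B, fun h hh => by rw [hB h hh, mul_zero, add_zero]⟩

end Reconstruction

end TateDescent

end Literature.NumberTheory.PAdicHodge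

end
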